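import Mathlib
import HarnessLib
import HarnessLib.Audit
import Summits.HodgeConjecture.Statement
import Summits.HodgeConjecture.HodgeConjecture.Theses.SevenfoldWeilCensus
import Summits.HodgeConjecture.HodgeConjecture.Theorems.WeilTypeLadderNonsplitSixfoldsSqrtMinus3
import Summits.HodgeConjecture.HodgeConjecture.Theorems.WeilTypeLadderNscComponentMinusTwo
import Summits.HodgeConjecture.HodgeConjecture.Theorems.Ring2HypothesesWeilDiscriminantHolds
import Literature.AlgebraicGeometry.HodgeTheory.ComplexGysinCorrespondence
import HarnessLib.Audit.Status.Attr

/-!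
Route: ThreefoldAbelJacobiPieces

CLOSED (superseded) 2026-08-28T04:28:42Z by planner-hodge-idea-4-g0-0 — reason: superseded:route-HodgeConjecture-EisensteinThreefoldPieces — superseded by route-HodgeConjecture-EisensteinThreefoldPieces — note: planner (hodge-idea-4, same seat, 35 min after filing): ODD-n PARITY WALL — on a Gaussian Weil SIXFOLD (psi^2 = -1) psi^* acts on the Weil plane weilClassesOf P psi 3 1 by (±i)^6 = -1, while every class produced by Schoen's cyclic-group cycles / van Geemen theta eigen-maps through an alpha-equivaria. The file is kept as the record of this route; refuted decls are indexed as negative knowledge (`ledger negatives`).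

# Route ThreefoldAbelJacobiPieces — non-split Gaussian Weil sixfolds as Abel–Jacobi pieces of
G-threefolds (Schoen one weight up)

LINE of ideator hodge-idea-4 (D-0145, lens = transfer, KEY director-hodge 2026-08-28T02:30Z) bearing
on rung H2 `SevenfoldWeilCensus.WeilSixfolds`
(stmt-HodgeConjecture-2524), cell (K = ℚ(i), type (3,3), discriminant class [−3] =
`WeilClassesComponent 3 1 [−3]`, non-split, 9-dimensional).
It suffices to show X = X1 ∧ X2 ∧ X3: (X1, ThreefoldPieceReach) every member of the cell sits on a
smooth projective family carrying its Weil class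
flatly, over a smooth irreducible quasi-projective base, an open set of whose fibres are
ℚ(i)-isogenous to ABEL–JACOBI PIECES (P, ψ₀) of smooth
projective threefolds X with a finite group of automorphisms ⟨α⟩, h^{3,0}(X) = 0, b₁(X) = 0 and no
invariant H³, the piece being cut out by an
ALGEBRAIC correspondence Γ ∈ CH²(P × X) whose cohomological action H³(X) ↠ H¹(P) intertwines the
group-algebra element Σ θᵢ αᵢ* with ψ₀*;
(X2, ThreefoldPieceWeilClasses) on every such Abel–Jacobi piece the ℚ(i)-Weil classes are algebraic
(Schoen's group-algebra-cycle theorem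
Schoen1988HodgeWeil Thm 0.2, which is stated for self-products of a variety of ANY dimension with an
automorphism, run on X instead of a curve);
(X3, OtherSixfoldCellsGaussian, RESIDUAL = the imported complement, not attacked here) every other
sixfold cell. No summit and no rung is proved by
filing this line; it is a thesis with three open cruxes.
Lean: `Summit.HodgeConjecture.HodgeConjecture.Theses.ThreefoldAbelJacobiPieces.ThreefoldPieceReach ∧
Summit.HodgeConjecture.HodgeConjecture.Theses.ThreefoldAbelJacobiPieces.ThreefoldPieceWeilClasses ∧
Summit.HodgeConjecture.HodgeConjecture.Theses.ThreefoldAbelJacobiPieces.OtherSixfoldCellsGaussian`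

## Assembly
Pure logic over the tree's fact-free door `Ring2.Hypotheses.weilSixfolds_iff_components`
(WeilSixfolds ↔ every cell (d, δ)): the cell d = 1,
δ = [−3] is proved from X1 and X2 by the Baire/algebraicity-locus lemma
`WeilTypeLadder.mem_algebraicClasses_of_isOpen_subset_algebraicityLocus`,
the isogeny transfer `HeckePrymWeilLine.stub_isogenyTransfer` and the transport
`HeckePrymWeilLine.owf_isoTransport` (all landed, sorry-free);
every other cell is X3. The deciding theorem `closes` in glue.lean elaborates (lean check rc 0, 0
sorry); all three cruxes are binders of `closes` (BC6), the Assembly item records the implication it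
proves.

CLOSES_TARGET: closes rung H2 of HodgeConjecture: Summit.HodgeConjecture.HodgeConjecture.Theses.SevenfoldWeilCensus.WeilSixfolds (D-0061; not the summit Statement) — the deciding theorem of this route concludes that registered leaf instead of the Statement decl `HodgeConjecture` (class rung: servable and labelled, never counted as concluding the summit Statement).

Rationale: WHY THIS LINE. TRANSFER LENS, first non-transferring step located by instrument: Schoen's method (S1
present the general cell member as a group-algebra piece of
J(C) for a G-curve family DOMINATING the cell; S2 type/discriminant; S3 group-algebra cycles have
non-zero Weil component; S4–S5 spread + Baire) ports
to the non-split sixfold cells only if S1 does, and S1 FAILS FOR EVERY GALOIS-COVER-OF-CURVES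
PRESENTATION of every non-split sixfold cell other than
NSC(−2): the class-complete balanced-type enumeration over all eight primitive reflection groups
(pub-hodge-ring2-ab-weil-1 G10Q-III-G30, 1 328 types
of Hurwitz dimension ≥ 9: the only non-split (3,3) types are class [−2] over ℚ(√−3)), the
level-character theorems (ab-weil-2 LEVEL-G35 §3.8: G₂₉ never
non-split, G₃₁ only in dimension ≤ 8; BORDISM-DISC-G12 THEOREM B), the metacyclic habitat maxima
(HABITAT-G41: 5/7/2 < 9), the monomial no-go (eigen-Pryms
of cyclic covers of the quotient curve: dominant only if étale over genus 4, hence split,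
G10Q-PARITY THEOREM L) and this seat's exact check that an
order-3 branch class over ℚ(i) has trivial local discriminant factor (calc/lambda_z3.py) close
weight one. The line therefore moves Schoen's construction
ONE WEIGHT UP: G-threefolds with h^{3,0} = 0 have intermediate Jacobians that are abelian varieties,
their equivariant moduli are far larger than those of
G-curves, the weight-3 local discriminant law is a different quadratic form (so "symmetric
presentation ⟹ split", THEOREM B, need not recur), and the
Abel–Jacobi isomorphism is induced by an algebraic correspondence when CH₀ is small
(BlochSrinivas1983, Murre1993; Voisin II Ch. 10), which is what lets
Schoen's cycles on X × X be pushed to P × P. Imported areas: intermediate Jacobians / decomposition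
of the diagonal (algebraic cycles), Griffiths residue
calculus for G-hypersurfaces (the census instrument), Schoen–van Geemen group-algebra cycles
(vanGeemen1994HodgeAV §7). No listed route of the sub uses
intermediate Jacobians or correspondences from threefolds (CyclicUnitaryPowers: powers of p-cyclic
curves/surfaces in the SPLIT regime; EisensteinMiddleThird:
ball-quotient Noether–Lefschetz; KuznetsovCYFactory: VHC anchors; UnitaryReflectionCovers (closed):
reflection covers of ℙ¹ in NSC(−2)).

RANKED CRUXES. #2 ThreefoldPieceReach (crux) — X1 — every sixfold (A, φ), φ² = −1, of discriminant
class [−3] with a rational (3,3) Weil class c is the fibre s₁ of a smooth projective family f : 𝒳 →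
S (S smooth irreducible quasi-projective) with a global class W restricting to c, and over a
non-empty open U ⊂ S every fibre is charted by (A″, φ″) ℚ(i)-isogenous (u flat, u ≫ v = m, v
intertwining) to an Abel–Jacobi piece (P, ψ₀) of a smooth projective threefold X with automorphisms
α : Fin k → Aut X closed under composition, Σ αᵢ* = 0 on H³, h^{3,0}(X) = 0, b₁(X) = 0, cut out by
an algebraic Γ ∈ CH²(P × X) with Γ_* : H³(X) ↠ H¹(P) and Γ_* ∘ Σ θᵢ αᵢ* = ψ₀* ∘ Γ_*, W restricting
into the Weil plane of (A″, φ″). [difficulty: XL] (why it might fail: no G-threefold family with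
h^{3,0}=0 may have a balanced ℚ(i)-piece of H³ of dimension 12 with ≥ 9 equivariant moduli
submersive onto the (3,3) period domain AND odd discriminant class; the weight-3 local law could
force split again.) [Schoen1988HodgeWeil, vanGeemen1994HodgeAV, BlochSrinivas1983, arXiv:2502.03415]
#3 ThreefoldPieceWeilClasses (crux) — X2 — for every smooth projective threefold X with
automorphisms α (closed under composition, no invariant H³, h^{3,0} = 0, b₁ = 0), every abelian
sixfold P with ψ₀² = −1 and every algebraic correspondence Γ ∈ CH²(P × X) whose action H³(X) → H¹(P)
is surjective and intertwines Σ θᵢ αᵢ* with ψ₀*, the ℚ(i)-Weil classes of (P, ψ₀) are algebraic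
(Schoen's Thm 0.2 on X × X pushed through Γ × Γ). [difficulty: L] (why it might fail: Schoen's
criterion needs the Künneth components of graph classes to have non-zero Weil component; pushed
through Γ×Γ from H³⊗H³ the relevant component lands in H²(P×P) only after two Abel–Jacobi transfers
and may vanish identically, as composite-conductor N-data do in weight one (R14.1).)
[Schoen1988HodgeWeil, Schoen1998HodgeWeilAddendum, Koike2004WeilHodge, Murre1993]
#6 OtherSixfoldCellsGaussian (crux) — X3 (RESIDUAL, imported complement) — the Weil classes are
algebraic on every sixfold cell other than (ℚ(i), [−3]): all cells with d ≠ 1, and the Gaussian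
cells of class ≠ [−3] (the split Gaussian cell [−1] is Markman's theorem in the tree's F0a; the
others are open). [difficulty: open-problem] (why it might fail: it contains every other non-split
sixfold cell (ℚ(√−2), ℚ(√−5), ℚ(√−6), … all classes), none of which is known; it is declared
residual and is exactly as hard as H2 minus one cell.) [vanGeemen1994HodgeAV,
MoonenZarhin1998WeilClasses, arXiv:2502.03415]

TWO-LAYER PLAN. X1 ⇐ (X1a CENSUS HIT: an explicit G-threefold family — candidates: μ₄-equivariant
complete intersections of type (2,3) ⊂ ℙ⁵, (2,2,2) ⊂ ℙ⁶, quartic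
double solids, double covers of ℙ³ branched in a μ₄-sextic — whose i-eigen-piece of H³ has Hodge
numbers (3,3), equivariant Kodaira–Spencer rank 9 onto
Sym-part, discriminant class [−3]) → (X1b the AJ correspondence Γ for that family is algebraic with
flat isogeny chart over an open set) → X1.
X2 ⇐ (X2a Schoen's Thm 0.2 on X × X for the μ₄-N-data of the census hit: the group-algebra cycle
classes span the ℚ(i)-exterior cube) → (X2b transport
through Γ × … × Γ to P) → X2. Nothing of this is filed now.

KILL CRITERIA. Refutation of X2 by an explicit (X, α, P, ψ₀, Γ) satisfying the hypotheses with a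
non-algebraic… is not available (it would refute HC); the route is
KILLED by: (i) the census instrument returning NO G-threefold family meeting X1a (h^{3,0}=0,
balanced ℚ(i)-piece of dimension 12, ≥ 9 submersive
equivariant moduli) among diagonal-group complete intersections and cyclic covers of degree ≤ 8 —
then X1 has no candidate presentation and the line
is retired `exhausted` with the census attached; (ii) a weight-3 analogue of THEOREM B (every
symmetric AJ-piece presentation has split class) — closes
the route `refuted:ThreefoldPieceReach`; (iii) H2 or the Gaussian cell proved elsewhere
(Markman-type secant sheaves for odd class) moots it.

NOT DECOMPOSED YET. The census hit (which G-threefold family), the discriminant computation of its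
piece (Pham/vanishing-lattice arithmetic), the construction of Γ
(decomposition of the diagonal for the hit: needs CH₀(X) supported on a surface, automatic for Fano
hits), and the Künneth bookkeeping of X2 are
layer-2 children, filed only after the instrument reports. BC5 witness is PLAN-ONLY:
stub_fanoPieceIsWeilType : for the census hit, the i-eigen-piece
is an abelian sixfold of Weil type (3,3) — via Griffiths residues; it lies outside S's known regime
because no non-split Gaussian sixfold has algebraic
Weil classes in print.

CHEAPEST FALSIFIER. INSTRUMENT I1 (one batched kit job, to be submitted by this seat right after
filing; in-seat pilot done by hand): Griffiths–Jacobian-ring census of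
diagonal-μ₄ (and μ₈, μ₁₂ ⊃ μ₄) actions on smooth complete-intersection and cyclic-cover threefolds
with h^{3,0} = 0 and h^{2,1} ≤ 52: per action, the
Hodge numbers of the i-eigen-piece of H³, the rank of the equivariant infinitesimal period map, and
(for Fermat-type members) the discriminant class of
the ℚ(i)-Hermitian form from the Pham basis. Pilot data point (by hand): the μ₄-quartic threefold y⁴
= f₄(x₀,…,x₃) has i-piece of type (16,4)+(4,16) —
not balanced, rejected; the census must find a balanced (3,3) hit with ≥ 9 moduli or the line dies
(kill criterion (i)).

NUMBERS. dim of the (3,3) cell = dim SU(3,3)/S(U(3)×U(3)) = 9; Galois-cover-of-curves habitats in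
non-split ℚ(i) sixfold cells: ≤ 8 (R¹⁰E₃₄, LEVEL-G35 §3.8),
metacyclic ≤ 5 (HABITAT-G41 T1); reflection-group balanced types of dimension ≥ 9 over ℚ(i): 48, all
split (G10Q-III-G30 TYPES.tsv). Threefold side:
h^{2,1} of candidate hosts: cubic 5, (2,2,2) 14, quartic double solid 10, (2,3) 20, quartic 30,
sextic double solid 52 (standard).

DEFINITION REQUESTS. None: the Abel–Jacobi piece is expressed through the tree's `corrAction μ`
(ComplexGysinCorrespondence) and `algebraicClasses (P.X ⊗ X) 2`; an
honest `IntermediateJacobian` structure (analogue of `Motives.Jacobian`) would shorten X1/X2 and may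
be requested by the first prover.

Novelty: Searches (2026-08-28): lit search --hybrid "intermediate Jacobian of a threefold with automorphism
is an abelian variety of Weil type; Hodge conjecture for Weil classes via Abel-Jacobi map" (8 docs:
carlson2017 pp120–123, green1994 pp196/214/234, voisin2003 — general AJ/normal-function material, no
Weil-type statement); lit search "Weil intermediate Jacobian cubic threefold automorphism" (6 local,
Clemens–Griffiths/cubic-threefold IJ literature, none on Weil type); lit galaxy search "Weil
type|intermediate Jacobian|exceptional Hodge classes" --star pdf (10 hits, nearest
pdf:-5037018919609425800 Laga–Shnidman Ceresa vanishing under H³(J)^{Aut C}=0 — curves, not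
threefolds); tree: rg over Theses/ of the sub (no route mentions intermediate Jacobians or
corrAction); ledger negatives --problem HodgeConjecture (6 entries, none related).
Nearest prior art found: Schoen1988HodgeWeil (group-algebra cycles on Cⁿ for a G-curve, Thm 0.2
general, applied in weight 1 only), Koike2004WeilHodge (Schoen's method for further weight-1 data),
vanGeemen1994HodgeAV §7 (survey of both methods), arXiv:2502.03415 (Markman: split sixfolds via
secant sheaves on generalised Kummers); half-twist constructions of Weil-type AVs from K3/CY
weight-2/3 Hodge structures (van Geemen, "Half twists of Hodge structures of CM-type", J. Math. Soc.
Japan 53 (2001)) give the Hodge structure but no cycles.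
Delta: run Schoen's group-algebra-cycle theorem on a G-THREEFOLD and push it through an algebraic
Abel–Jacobi corr  [refs: 2502.03415]

Barriers (technique_class: explicit-family, abel-jacobi, group-cycles, variational): - technique_class: explicit-family, abel-jacobi, group-cycles, variational
- Literature.Barriers.HodgeConjecture.Voisin2003_generalHypersurface_noIntegralClassInF: outside —
Griffiths' programme (Lefschetz pencil + Jacobi inversion + normal functions on a GENERAL
hypersurface slice) is not used; the Abel–Jacobi map enters only for SPECIAL G-threefolds with
h^{3,0} = 0, where J(X) is an abelian variety and AJ is induced by an algebraic correspondence Γ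
(decomposition of the diagonal), and algebraicity comes from explicit group-algebra cycles on X × X,
not from inverting AJ on a general member.
- Literature.Barriers.HodgeConjecture.Voisin2003_generalHypersurface_noIntegralClassInF_Narrow:
outside for the same reason — no slice of Hodge level ≥ 2 is asked to have surjective Abel–Jacobi
map; X1 demands h^{3,0}(X) = 0 (level-one H³) precisely so that AJ is algebraic.
- Literature.Barriers.HodgeConjecture.BlochSrinivas1983_hodgeTypeL0_vanish_of_chowZeroSupported:
used as a RESOURCE — CH₀(X) supported on a surface ⟹ h^{3,0} = 0 and the AJ correspondence is
algebraic is the input X1 needs; its restrictive direction is why the census is confined to hosts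
with h^{3,0} = 0 (Fano / rationally connected G-threefolds).
- Literature.Barriers.HodgeConjecture.Clemens1983_griffithsGroup_infiniteRank: outside — the line
works with AJ on all of H³(X) into an abelian variety; homological-versus-algebraic equivalence on X
never enters.
- Literature.Barriers.HodgeConjecture.Andre1996_hodgeClassesOn

History (route lifecycle, newest last):
- 2026-08-28T04:28:42Z · CLOSED superseded — superseded:route-HodgeConjecture-EisensteinThreefoldPieces (planner-hodge-idea-4-g0-0)

sub-problem: HodgeConjecture · status: closed(superseded) · opened planner-hodge-idea-4-g0-0 2026-08-28T03:48:45Z · rev 0 · ledger route-HodgeConjecture-ThreefoldAbelJacobiPieces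
GENERATED by the gate from the ledger (D-0016/17). Provers cite these decls: `theorem foo : Summit.HodgeConjecture.HodgeConjecture.Theses.ThreefoldAbelJacobiPieces.<Decl> := …` in Summits/HodgeConjecture/HodgeConjecture/Theorems/<Name>.lean.
-/

namespace Summit.HodgeConjecture.HodgeConjecture.Theses.ThreefoldAbelJacobiPieces

open scoped BigOperators Topology Manifold Classical MeasureTheory ProbabilityTheory Matrix InnerProductSpace ComplexConjugate ContinuousMap
open Filter Set Function TopologicalSpace MeasureTheory

attribute [summit_statement] _root_.HodgeConjecture
attribute [summit_statement] _root_.Summit.HodgeConjecture.HodgeConjecture.Theses.SevenfoldWeilCensus.WeilSixfolds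

/-- item stmt-HodgeConjecture-25501 · crux · rank 2 · closed · moot by None · by planner
why it might fail: no G-threefold family with h^{3,0}=0 may have a balanced ℚ(i)-piece of H³ of dimension 12 with ≥ 9 equivariant moduli submersive onto the (3,3) period domain AND odd discriminant class; the weight-3 local law could force split again.
sources: Schoen1988HodgeWeil, vanGeemen1994HodgeAV, BlochSrinivas1983, arXiv:2502.03415
[crux] X1 — every sixfold (A, φ), φ² = −1, of discriminant class [−3] with a rational (3,3) Weil
class c is the fibre s₁ of a smooth projective family f : 𝒳 → S (S smooth irreducible
quasi-projective) with a global class W restricting to c, and over a non-empty open U ⊂ S every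
fibre is charted by (A″, φ″) ℚ(i)-isogenous (u flat, u ≫ v = m, v intertwining) to an Abel–Jacobi
piece (P, ψ₀) of a smooth projective threefold X with automorphisms α : Fin k → Aut X closed under
composition, Σ αᵢ* = 0 on H³, h^{3,0}(X) = 0, b₁(X) = 0, cut out by an algebraic Γ ∈ CH²(P × X) with
Γ_* : H³(X) ↠ H¹(P) and Γ_* ∘ Σ θᵢ αᵢ* = ψ₀* ∘ Γ_*, W restricting into the Weil plane of (A″, φ″).
[difficulty: XL] -/
@[route_item "route-HodgeConjecture-ThreefoldAbelJacobiPieces", crux]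
def ThreefoldPieceReach : Prop :=
  open CategoryTheory Literature.AlgebraicGeometry.Motives Literature.AlgebraicGeometry.HodgeTheory Literature.AlgebraicGeometry.VanGeemen1994 in ∀ (A : AbelianVariety ℂ) (φ : A ⟶ A), A.dim = 2 * 3 → IsSmoothProjective (2 * 3) A.X → φ ≫ φ = -((1 : ℕ) • 𝟙 A) → ∀ (e : ProjectiveEmbedding A.X) (a : complexBetti (projectiveSpace e.n ℂ) 2), IsRationalClass a → a ≠ 0 → HasWeilDiscriminantNondeg A φ 3 1 (((1 : ℕ) : ℂ) • complexBetti.map e.ι 2 a + complexBetti.map φ.hom.hom.hom 2 (complexBetti.map e.ι 2 a)) (QuotientGroup.mk (Units.mk0 (-3 : ℚ) (by norm_num))) → ∀ c : complexBetti A.X (2 * 3), IsRationalClass c → IsOfHodgeType (2 * 3) A.X (2 * 3) 3 3 c → c ∈ weilClassesOf A φ 3 1 → ∃ (𝒳 S : SchemeOver ℂ) (f : 𝒳 ⟶ S) (s₁ : ComplexPoints S) (ι : A.X ≅ fiberOver f s₁) (W : complexBetti 𝒳 (2 * 3)) (U : Set (ComplexPoints S)), IsSmoothProjectiveFamily f (2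 * 3) ∧ IsQuasiProjectiveOver 𝒳 ∧ IsQuasiProjectiveOver S ∧ IrreducibleSpace S.left ∧ AlgebraicGeometry.Smooth S.hom ∧ complexBetti.map ι.hom (2 * 3) (complexBetti.map (fiberι f s₁) (2 * 3) W) = c ∧ IsOpen U ∧ U.Nonempty ∧ ∀ t ∈ U, ∃ (B : AbelianVariety ℂ) (χ : B ⟶ B) (eB : B.X ≅ fiberOver f t), B.dim = 2 * 3 ∧ χ ≫ χ = -((1 : ℕ) • 𝟙 B) ∧ complexBetti.map eB.hom (2 * 3) (complexBetti.map (fiberι f t) (2 * 3) W) ∈ weilClassesOf B χ 3 1 ∧ ∃ (X : SchemeOver ℂ) (hX : IsSmoothProjective 3 X) (k : ℕ) (α : Fin k → (X ⟶ X)) (θ : Fin k → ℤ) (P : AbelianVariety ℂ) (hP : IsSmoothProjective (2 * 3) P.X) (ψ : P ⟶ P) (μ : OrientationFamily) (Γ : complexBetti (MonoidalCategoryStruct.tensorObj P.X X) (2 * 2)) (u : B ⟶ P) (v : P ⟶ B) (m : ℕ), let T : complexBetti X 3 →ₗ[ℂ] complexBetti P.X 1 := corrAction μ hP hX (by norm_num)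 Γ; (∀ i, IsIso (α i)) ∧ (∀ i j, ∃ l, α i ≫ α j = α l) ∧ (∑ i, (complexBetti.map (α i) 3).hom = 0) ∧ (∀ x : complexBetti X 3, IsOfHodgeType 3 X 3 3 0 x → x = 0) ∧ Module.finrank ℂ (complexBetti X 1) = 0 ∧ P.dim = 2 * 3 ∧ ψ ≫ ψ = -((1 : ℕ) • 𝟙 P) ∧ μ.HasPoincareDuality ∧ Γ ∈ algebraicClasses (MonoidalCategoryStruct.tensorObj P.X X) 2 ∧ Function.Surjective T ∧ T ∘ₗ (∑ i, ((θ i : ℤ) : ℂ) • (complexBetti.map (α i) 3).hom) = (complexBetti.map ψ.hom.hom.hom 1).hom ∘ₗ T ∧ 0 < m ∧ u ≫ v = m • 𝟙 B ∧ AlgebraicGeometry.Flat u.hom.hom.hom.left ∧ v ≫ χ = ψ ≫ v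

/-- item stmt-HodgeConjecture-25502 · crux · rank 3 · closed · moot by None · by planner
why it might fail: Schoen's criterion needs the Künneth components of graph classes to have non-zero Weil component; pushed through Γ×Γ from H³⊗H³ the relevant component lands in H²(P×P) only after two Abel–Jacobi transfers and may vanish identically, as composite-conductor N-data do in weight one (R14.1).
sources: Schoen1988HodgeWeil, Schoen1998HodgeWeilAddendum, Koike2004WeilHodge, Murre1993
[crux] X2 — for every smooth projective threefold X with automorphisms α (closed under composition,
no invariant H³, h^{3,0} = 0, b₁ = 0), every abelian sixfold P with ψ₀² = −1 and every algebraic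
correspondence Γ ∈ CH²(P × X) whose action H³(X) → H¹(P) is surjective and intertwines Σ θᵢ αᵢ* with
ψ₀*, the ℚ(i)-Weil classes of (P, ψ₀) are algebraic (Schoen's Thm 0.2 on X × X pushed through Γ ×
Γ). [difficulty: L] -/
@[route_item "route-HodgeConjecture-ThreefoldAbelJacobiPieces", crux]
def ThreefoldPieceWeilClasses : Prop :=
  open CategoryTheory Literature.AlgebraicGeometry.Motives Literature.AlgebraicGeometry.HodgeTheory Literature.AlgebraicGeometry.VanGeemen1994 in ∀ (X : SchemeOver ℂ) (hX : IsSmoothProjective 3 X) (k : ℕ) (α : Fin k → (X ⟶ X)) (θ : Fin k → ℤ) (P : AbelianVariety ℂ) (hP : IsSmoothProjective (2 * 3) P.X) (ψ : P ⟶ P) (μ : OrientationFamily) (Γ : complexBetti (MonoidalCategoryStruct.tensorObj P.X X) (2 * 2)), let T : complexBetti X 3 →ₗ[ℂ] complexBetti P.X 1 := corrAction μ hP hX (by norm_num) Γ; (∀ i, IsIso (α i)) → (∀ i j, ∃ l, α i ≫ α j = α l) → (∑ i, (complexBetti.map (α i) 3).hom = 0) → (∀ x : complexBetti X 3, IsOfHodgeType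 3 X 3 3 0 x → x = 0) → Module.finrank ℂ (complexBetti X 1) = 0 → P.dim = 2 * 3 → ψ ≫ ψ = -((1 : ℕ) • 𝟙 P) → μ.HasPoincareDuality → Γ ∈ algebraicClasses (MonoidalCategoryStruct.tensorObj P.X X) 2 → Function.Surjective T → T ∘ₗ (∑ i, ((θ i : ℤ) : ℂ) • (complexBetti.map (α i) 3).hom) = (complexBetti.map ψ.hom.hom.hom 1).hom ∘ₗ T → weilClassesOf P ψ 3 1 ≤ algebraicClasses P.X 3

/-- item stmt-HodgeConjecture-25503 · crux · rank 6 · closed · moot by None · by planner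
why it might fail: it contains every other non-split sixfold cell (ℚ(√−2), ℚ(√−5), ℚ(√−6), … all classes), none of which is known; it is declared residual and is exactly as hard as H2 minus one cell.
sources: vanGeemen1994HodgeAV, MoonenZarhin1998WeilClasses, arXiv:2502.03415
[crux] X3 (RESIDUAL, imported complement) — the Weil classes are algebraic on every sixfold cell
other than (ℚ(i), [−3]): all cells with d ≠ 1, and the Gaussian cells of class ≠ [−3] (the split
Gaussian cell [−1] is Markman's theorem in the tree's F0a; the others are open). [difficulty:
open-problem] -/
@[route_item "route-HodgeConjecture-ThreefoldAbelJacobiPieces", crux]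
def OtherSixfoldCellsGaussian : Prop :=
  open CategoryTheory Literature.AlgebraicGeometry.Motives Literature.AlgebraicGeometry.HodgeTheory Literature.AlgebraicGeometry.VanGeemen1994 in (∀ d : ℕ, 0 < d → d ≠ 1 → ∀ δ : weilNormResidueGroup d, Summit.HodgeConjecture.HodgeConjecture.Ring2.Hypotheses.WeilClassesComponent 3 d δ) ∧ (∀ δ : weilNormResidueGroup 1, δ ≠ QuotientGroup.mk (Units.mk0 (-3 : ℚ) (by norm_num)) → Summit.HodgeConjecture.HodgeConjecture.Ring2.Hypotheses.WeilClassesComponent 3 1 δ)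

/-- item stmt-HodgeConjecture-25504 · assembly · rank 1 · closed · moot by None · by planner
sources: Schoen1988HodgeWeil, vanGeemen1994HodgeAV
[assembly] X1 → X2 → X3 → WeilSixfolds (the deciding theorem `closes` proves exactly this
implication; kept as the schema's assembly item). -/
@[route_item "route-HodgeConjecture-ThreefoldAbelJacobiPieces"]
def Assembly : Prop :=
  Summit.HodgeConjecture.HodgeConjecture.Theses.ThreefoldAbelJacobiPieces.ThreefoldPieceReach → Summit.HodgeConjecture.HodgeConjecture.Theses.ThreefoldAbelJacobiPieces.ThreefoldPieceWeilClasses → Summit.HodgeConjecture.HodgeConjecture.Theses.ThreefoldAbelJacobiPieces.OtherSixfoldCellsGaussian → Summit.HodgeConjecture.HodgeConjecture.Theses.SevenfoldWeilCensus.WeilSixfolds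

/-! D-0027 §2.1 — DECIDING THEOREM (planner-authored via `route open/edit --closes-file`; by planner-hodge-idea-4-g0-0 2026-08-28T03:48:45Z) — ARCHIVED: route closed (superseded) 2026-08-28T04:28:42Z; kept so importers keep building:
its hypotheses are this route's items and its conclusion the registered leaf `Summit.HodgeConjecture.HodgeConjecture.Theses.SevenfoldWeilCensus.WeilSixfolds` (rung H2, D-0061) (glue_lint), and it elaborates with this file. -/

@[closes "route-HodgeConjecture-ThreefoldAbelJacobiPieces"] theorem closes (h1 : ThreefoldPieceReach) (h2 : ThreefoldPieceWeilClasses) (h3 : OtherSixfoldCellsGaussian) :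
    Summit.HodgeConjecture.HodgeConjecture.Theses.SevenfoldWeilCensus.WeilSixfolds := by
  -- the route's own cell: (ℚ(i), sixfolds, discriminant class [-3]) from X1 (Abel–Jacobi piece reach) and X2 (piece algebraicity)
  have key : Summit.HodgeConjecture.HodgeConjecture.Ring2.Hypotheses.WeilClassesComponent 3 1
      (QuotientGroup.mk (Units.mk0 (-3 : ℚ) (by norm_num))) := by
    intro A φ hA hX hφ e a ha ha0 hdisc c hcQ hcH hcW
    obtain ⟨𝒳, S, f, s₁, ι, W, U, hf, h𝒳, hSqp, hirr, hsm, hιc, hU, hUne, hPiece⟩ :=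
      h1 A φ hA hX hφ e a ha ha0 hdisc c hcQ hcH hcW
    rw [← hιc]
    haveI := hirr
    refine Summit.HodgeConjecture.HodgeConjecture.Theorems.isoInvariance_proof ι 3 _
      (Summit.HodgeConjecture.HodgeConjecture.WeilTypeLadder.mem_algebraicClasses_of_isOpen_subset_algebraicityLocus
        f h𝒳 hSqp hsm hf W hU hUne ?_ s₁)
    intro t ht
    obtain ⟨B, χ, eB, hBdim, hχ, hWeil, X, hX3, k, α, θ, P, hP, ψ, μ, Γ, u, v, m, hiso, hcl, hsum, hlev, hq,
      hPdim, hψ, hμ, hΓ, hsurj, hinter, hm, huv, hu, hv⟩ := hPiece t ht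
    have hPalg : Literature.AlgebraicGeometry.HodgeTheory.weilClassesOf P ψ 3 1 ≤
        Literature.AlgebraicGeometry.HodgeTheory.algebraicClasses P.X 3 :=
      h2 X hX3 k α θ P hP ψ μ Γ hiso hcl hsum hlev hq hPdim hψ hμ hΓ hsurj hinter
    have hχℤ : CategoryTheory.CategoryStruct.comp χ χ = -(((1 : ℕ) : ℤ) • CategoryTheory.CategoryStruct.id B) := by
      rw [hχ, natCast_zsmul]
    have hBalg : Literature.AlgebraicGeometry.HodgeTheory.weilClassesOf B χ 3 1 ≤
        Literature.AlgebraicGeometry.HodgeTheory.algebraicClasses B.X 3 :=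
      Summit.HodgeConjecture.HodgeConjecture.Theorems.HeckePrymWeilLine.stub_isogenyTransfer 1 3 B _ χ ψ hBdim
        hPdim hχℤ u v m hm huv hu hv hPalg
    exact Summit.HodgeConjecture.HodgeConjecture.Theorems.HeckePrymWeilLine.owf_isoTransport _ B eB 3 _ (hBalg hWeil)
  refine Summit.HodgeConjecture.HodgeConjecture.Ring2.Hypotheses.weilSixfolds_iff_components.2 fun d hd δ => ?_
  by_cases hd1 : d = 1
  · subst hd1
    by_cases hδ : δ = QuotientGroup.mk (Units.mk0 (-3 : ℚ) (by norm_num))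
    · subst hδ
      exact key
    · exact h3.2 δ hδ
  · exact h3.1 d hd hd1 δ

end Summit.HodgeConjecture.HodgeConjecture.Theses.ThreefoldAbelJacobiPieces
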